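import Summits.ABC.IUTFork.Repair.RHTameBandLicence
import Summits.ABC.IUTFork.Cor312LicenceTameBoundarySubsumesTame
import HarnessLib

/-!
# IUT REPAIR branch → R-H ROUND 1 (D-0079 / D-0107), row 5 «tame-band-licence»: the «OR BALL PLACES» rider TYPED —
# `HStarBallBandLicence` over the genuine `K`-level datum, its reduction to the tame decl, and its DECLARED equivalence with the (xi-f)
# licence on the torsion-free sub-wild (ball) stratum

Seat abc-iut-rh-typ-5 (R-H ROUND 1 PAIR n = 5 TYPER). Sequel of `Repair.RHTameBandLicence` (p458742), whose docstring flagged the rider «(e_w < p−1,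
or ball places)» of RH-CANDIDATES row 5 as NOT typed; ROUND1.tsv row 5 was signed «KEEP-as-declared-EQUIVALENCE on the TAME/BALL stratum» (ref-2,
tst-5 17:19:02Z scope addendum citing abc-iut-w5-d068's `CandInternal2RealLabelsLicenceBall`). This file types the rider so that the deciding decl
matches the signed scope. HONEST FRAMING: `HStarBallBandLicence` is an R-H CANDIDATE HYPOTHESIS (claim-tagged `def … : Prop`), never a Literature
fact; nothing here asserts abc proved or refuted; no side is taken on [IUTchIII] Cor. 3.12 or on any author; typed ≠ proved. Inputs BY NAME:
abc-iut-D1-prv `Cor312Prov.licence_settingPrVolSharp_pilotDataOfK_iff_of_boundary` (p456609: at a genuine datum whose bad fibres are torsion-free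
sub-wild — `p > 2`, `e_p ≤ p − 1`, no non-trivial `p`-th root of unity in `K_x` — the licence is abc-iut-w5-d009's exact integer predicate),
`Thm311.Real.forall_pow_prime_eq_one_of_absRamificationIdx_le_sub_two` (`Cor312LicenceTameBoundarySubsumesTame`: tame ⇒ torsion-free),
`absRamificationIdx_rescaledCompletion`, this seat's `RH.TameBandLicence.Cell` / `cell_iff_tame_exact` / `HStarTameBandLicence`,
abc-iut-w5-d009 `exists_qPinned_and_hull_settingPrVolSharp_iff_licence`, abc-iut-w5-d236 `norm_qIdele_le_one_of_realises`.

BALL PLACE (the rider's «ball places», START-HERE §1 BALL-SHELL CLOSED FORM): a bad place `w ∣ p` with `p > 2`, `e_w ≤ p − 1` and `μ_p(K_w) = 1`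
— there `log_p 𝒪^×_{K_w} = 𝔪_w` is a ball (`UnitLogTorsionFreeBallCriterion`), the TAME places (`e_w ≤ p − 2`) being the sub-case where
`μ_p(K_w) = 1` is automatic.

WHAT IS TYPED / PROVED (namespace `Summit.ABC.IUTFork.Repair.RH.TameBandLicence`, continued):
* **`HStarBallBandLicence D`** — row 5's cell `(j²−1)·P_w ≤ j·(e_w−1) + ((j²·P_w − 1) mod e_w)` demanded at every BALL bad place and every label;
  no claim elsewhere.
* `hStarTameBandLicence_of_hStarBall` — the ball decl implies the tame decl (tame places are ball places).
* **`licence_settingPrVolSharp_pilotDataOfK_iff_hStarBall_of_boundary`** — at a genuine datum all of whose bad fibres are uniformly torsion-free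
  sub-wild, for REALISING Θ- and q-ideles: `Thm311ToCor312.Licence (settingPrVolSharp (pilotDataOfK D K) …) ↔ HStarBallBandLicence D` (the
  DECLARED stratum-equivalence on the ball stratum, k4 amended); `exists_qPinned_and_hull_settingPrVolSharp_pilotDataOfK_of_hStarBall_of_boundary`
  (the START-HERE §3 (k2) target shape).
[cite: Mochizuki2012, IUTchI Def. 3.1 (b),(c) pp. 61–62, Ex. 3.2 (iv) p. 71; IUTchIII Step (xi-f) p. 184; IUTchIV Prop. 1.2 (i)(ii) p. 10]
[cite: NeukirchANT1999, Ch. II Prop. (5.7), (7.13)] [cite: DupuyHilado2025, §3.3, §3.4, §4.9] [claim: Mochizuki2012, status: disputed] for every IUT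
sentence quoted. Axioms: standard. No instance, no notation.
-/

noncomputable section

open Set Metric Function NumberField IsDedekindDomain
open scoped Pointwise

namespace Summit.ABC.IUTFork.Repair.RH.TameBandLicence

open Literature.AnabelianGeometry.AbsoluteAnabelian Literature.IUT.LogThetaLattice Literature.IUT.LogVolume
  Literature.IUT.HodgeTheaters Literature.NumberTheory.NumberFields Literature.NumberTheory.GaloisRepresentations.Ultrametric
open Summit.ABC.IUTFork.Thm311 Summit.ABC.IUTFork.Thm311.Real Summit.ABC.IUTFork.Cor312 Summit.ABC.IUTFork.Cor312.Setting
  Summit.ABC.IUTFork.Cor312Vol Summit.ABC.IUTFork.Cor312Prov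

variable {F K Fbar : Type} [Field F] [NumberField F] [Field K] [NumberField K] [Algebra F K] [Field Fbar]
  [Algebra F Fbar] [Algebra K Fbar] {E : WeierstrassCurve F} [E.IsElliptic] {l : ℕ} {Pb : BadPlacePredicates K}

/-- **H⋆₅♭ «tame-band-licence, ball rider» — RH-CANDIDATES row 5 with its «or ball places» clause typed** [R-H candidate, hypothesis — not a
fact]. At the genuine `K`-level datum `pilotDataOfK D K`: for every prime `p`, label `j = i+1 ∈ 𝔽_l^⋇` and place `w ∣ p` of `K` that is BAD and
a BALL place (`p > 2`, `e_w ≤ p − 1`, no `ζ ≠ 1` in `K_w` with `ζ^p = 1`), with `P_w ∈ ℕ` the integral q-degree (`qPilot w = P_w`):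
`(j²−1)·P_w ≤ j·(e_w−1) + ((j²·P_w − 1) mod e_w)` (`Cell e_w P_w j`). Quoting the row: «on TAME bad packets (e_w < p-1, or ball places): forall j:
(j^2-1)*m_q <= j*(e_w-1) + ((j^2*m_q - 1) mod e_w) (theta_j = j end of the band); no claim at wild packets».
[cite: Mochizuki2012, IUTchI Ex. 3.2 (iv) p. 71; IUTchIV Prop. 1.2 (i)(ii) p. 10] [cite: NeukirchANT1999, Ch. II Prop. (5.7)]
[claim: Mochizuki2012, status: disputed] -/
@[claim "Mochizuki2012" "disputed"]
def HStarBallBandLicence (D : InitialThetaData F K Fbar E l Pb) : Prop :=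
  ∀ (pp : Nat.Primes) (i : Fin (pilotDataOfK D K).lstar) (w : (thetaIndex (pilotDataOfK D K)).Fibre (.inr pp)),
    haveI : Fact (pp : ℕ).Prime := ⟨pp.2⟩
    placeOf (pilotDataOfK D K) pp.1 w ∈ (pilotDataOfK D K).S →
      2 < (pp : ℕ) → (placeOf (pilotDataOfK D K) pp.1 w).asIdeal.ramificationIdx ℤ ≤ (pp : ℕ) - 1 →
        (∀ ζ : kOf (pilotDataOfK D K) pp.1 w, ζ ^ (pp : ℕ) = 1 → ζ = 1) →
          ∀ P : ℕ, (pilotDataOfK D K).qPilot (placeOf (pilotDataOfK D K) pp.1 w) = P →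
            Cell (((placeOf (pilotDataOfK D K) pp.1 w).asIdeal.ramificationIdx ℤ : ℕ) : ℤ) (P : ℤ) (((i : ℕ) + 1 : ℕ) : ℤ)

variable (D : InitialThetaData F K Fbar E l Pb)

/-- Unfolding lemma for `HStarBallBandLicence`. [folklore] -/
theorem hStarBall_iff :
    HStarBallBandLicence D ↔
      ∀ (pp : Nat.Primes) (i : Fin (pilotDataOfK D K).lstar) (w : (thetaIndex (pilotDataOfK D K)).Fibre (.inr pp)),
        haveI : Fact (pp : ℕ).Prime := ⟨pp.2⟩
        placeOf (pilotDataOfK D K) pp.1 w ∈ (pilotDataOfK D K).S →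
          2 < (pp : ℕ) → (placeOf (pilotDataOfK D K) pp.1 w).asIdeal.ramificationIdx ℤ ≤ (pp : ℕ) - 1 →
            (∀ ζ : kOf (pilotDataOfK D K) pp.1 w, ζ ^ (pp : ℕ) = 1 → ζ = 1) →
              ∀ P : ℕ, (pilotDataOfK D K).qPilot (placeOf (pilotDataOfK D K) pp.1 w) = P →
                Cell (((placeOf (pilotDataOfK D K) pp.1 w).asIdeal.ramificationIdx ℤ : ℕ) : ℤ) (P : ℤ) (((i : ℕ) + 1 : ℕ) : ℤ) :=
  Iff.rfl

/-- **The ball decl implies the tame decl**: a TAME bad place (`p > 2`, `e_w ≤ p − 2`) is a ball place — `e_w ≤ p − 1` and `μ_p(K_w) = 1`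
(`Thm311.Real.forall_pow_prime_eq_one_of_absRamificationIdx_le_sub_two` at `K_w`, `e(K_w/ℚ_p) = e_w` by `absRamificationIdx_rescaledCompletion`).
[cite: NeukirchANT1999, Ch. II Prop. (5.7), (7.13)] [claim: Mochizuki2012, status: disputed] -/
theorem hStarTameBandLicence_of_hStarBall (h : HStarBallBandLicence D) : HStarTameBandLicence D := by
  intro pp i w hw hp2 hew P hP
  haveI : Fact (pp : ℕ).Prime := ⟨pp.2⟩
  have heK : absRamificationIdx (pp : ℕ) (kOf (pilotDataOfK D K) pp.1 w) =
      (placeOf (pilotDataOfK D K) pp.1 w).asIdeal.ramificationIdx ℤ :=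
    absRamificationIdx_rescaledCompletion K (pp : ℕ) (placeOf (pilotDataOfK D K) pp.1 w)
      (natCast_mem_placeOf (pilotDataOfK D K) pp.1 w)
  have hμ : ∀ ζ : kOf (pilotDataOfK D K) pp.1 w, ζ ^ (pp : ℕ) = 1 → ζ = 1 :=
    forall_pow_prime_eq_one_of_absRamificationIdx_le_sub_two (pp : ℕ) (kOf (pilotDataOfK D K) pp.1 w) hp2 (by rw [heK]; exact hew)
  exact h pp i w hw hp2 (by omega) hμ P hP

/-! ## At the window bed, all bad fibres uniformly torsion-free sub-wild: the declared equivalence and the k2 door -/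

variable {logv : PadicLogs K} (hlog : LogvAnalytic logv)
  (M : Type) [Field M] [NumberField M]
  (archPk : ∀ (j : (thetaIndex (pilotDataOfK D K)).Label) (vQ : (thetaIndex (pilotDataOfK D K)).VQ),
    Set ((logShellsDH (pilotDataOfK D K) logv).Packet j vQ))
  (archSub : ∀ (j : (thetaIndex (pilotDataOfK D K)).Label) (v : (thetaIndex (pilotDataOfK D K)).V),
    Set ((logShellsDH (pilotDataOfK D K) logv).Packet j ((thetaIndex (pilotDataOfK D K)).over v)))
  (Ψ : ℤ → ∀ v : (thetaIndex (pilotDataOfK D K)).V, v ∈ (thetaIndex (pilotDataOfK D K)).Vbad →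
    Set ((logShellsDH (pilotDataOfK D K) logv).StarPacket v))
  (act : ℤ → ∀ v : (thetaIndex (pilotDataOfK D K)).V, v ∈ (thetaIndex (pilotDataOfK D K)).Vbad →
    (logShellsDH (pilotDataOfK D K) logv).StarPacket v → Module.End ℚ ((logShellsDH (pilotDataOfK D K) logv).StarPacket v))
  (Mmod : ℤ → ∀ j : (thetaIndex (pilotDataOfK D K)).LabelStar, Set ((logShellsDH (pilotDataOfK D K) logv).GlobalPacket j.1))
  (region : ℤ → ∀ j : (thetaIndex (pilotDataOfK D K)).LabelStar, FinDivisor M → ∀ vQ : (thetaIndex (pilotDataOfK D K)).VQ,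
    Set ((logShellsDH (pilotDataOfK D K) logv).Packet j.1 vQ))
  (n : ℤ) {HT : Type} {LogLink : HT → HT → Type} {IsFull : ∀ {s t : HT}, LogLink s t → Prop}
  (lat : LGPGaussianLogThetaLattice LogLink IsFull)
  {Frd : Type} {IsoF : Frd → Frd → Type} {Ob : Frd → Type} {realify : Frd → Frd} {Strip : Type}
  {IsoS : Strip → Strip → Type} {Mv : ∀ v : (thetaIndex (pilotDataOfK D K)).V, v ∈ (thetaIndex (pilotDataOfK D K)).Vbad → Type}
  [∀ v h, Monoid (Mv v h)]
  (sig : GlobalLGPFrobenioidSignature (thetaIndex (pilotDataOfK D K)).lstar (thetaIndex (pilotDataOfK D K)).V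
    (· ∈ (thetaIndex (pilotDataOfK D K)).Vbad) Frd IsoF Ob realify Strip IsoS Mv)
  (split : SplittingMonoids Mv) {ObΔ : Type} {N : ∀ v : (thetaIndex (pilotDataOfK D K)).V, v ∈ (thetaIndex (pilotDataOfK D K)).Vbad → Type}
  [∀ v h, Monoid (N v h)] (qData : QPilotData ObΔ N)
  (tq : ∀ (pp : Nat.Primes) (x : (thetaIndex (pilotDataOfK D K)).Fibre (.inr pp)),
    haveI : Fact (pp : ℕ).Prime := ⟨pp.2⟩; kOf (pilotDataOfK D K) pp.1 x)
  (t : ∀ (pp : Nat.Primes) (_ : Fin (pilotDataOfK D K).lstar) (x : (thetaIndex (pilotDataOfK D K)).Fibre (.inr pp)),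
    haveI : Fact (pp : ℕ).Prime := ⟨pp.2⟩; kOf (pilotDataOfK D K) pp.1 x)
  (htq0 : ∀ pp x, tq pp x ≠ 0)
  (htq1 : ∀ (pp : Nat.Primes) (x : (thetaIndex (pilotDataOfK D K)).Fibre (.inr pp)),
    haveI : Fact (pp : ℕ).Prime := ⟨pp.2⟩; placeOf (pilotDataOfK D K) pp.1 x ∉ (pilotDataOfK D K).S → ‖tq pp x‖ = 1)
  (col : ℤ → Column (logShellsDH (pilotDataOfK D K) logv))
  (ht0 : ∀ pp i x, t pp i x ≠ 0)
  (ht : ∀ (pp : Nat.Primes) (i : Fin (pilotDataOfK D K).lstar) (x : (thetaIndex (pilotDataOfK D K)).Fibre (.inr pp)),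
    haveI : Fact (pp : ℕ).Prime := ⟨pp.2⟩
    Real.log ‖t pp i x‖ = -((pilotDataOfK D K).thetaPilot i (placeOf (pilotDataOfK D K) pp.1 x)) *
      logNorm K (placeOf (pilotDataOfK D K) pp.1 x) / localDegree K (placeOf (pilotDataOfK D K) pp.1 x))
  (htq : ∀ (pp : Nat.Primes) (x : (thetaIndex (pilotDataOfK D K)).Fibre (.inr pp)),
    haveI : Fact (pp : ℕ).Prime := ⟨pp.2⟩
    Real.log ‖tq pp x‖ = -((pilotDataOfK D K).qPilot (placeOf (pilotDataOfK D K) pp.1 x)) *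
      logNorm K (placeOf (pilotDataOfK D K) pp.1 x) / localDegree K (placeOf (pilotDataOfK D K) pp.1 x))

include ht0 ht htq in
/-- **THE DECLARED STRATUM-EQUIVALENCE ON THE BALL STRATUM**: at a genuine datum all of whose bad fibres are uniformly torsion-free sub-wild
(`p > 2`, `e(x|p) = e_p ≤ p − 1`, `μ_p(K_x) = 1`), for REALISING Θ- and q-ideles, the (xi-f) licence at the window bed holds IFF H⋆₅♭ holds —
abc-iut-D1-prv's `Cor312Prov.licence_settingPrVolSharp_pilotDataOfK_iff_of_boundary` read through `cell_iff_tame_exact`.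
[cite: Mochizuki2012, IUTchI Ex. 3.2 (iv) p. 71; IUTchIII Step (xi-f) p. 184; IUTchIV Prop. 1.2 (i)(ii) p. 10] [cite: NeukirchANT1999, Ch. II Prop. (5.7)]
[cite: DupuyHilado2025, §3.3, §3.4, §4.9] [claim: Mochizuki2012, status: disputed] -/
theorem licence_settingPrVolSharp_pilotDataOfK_iff_hStarBall_of_boundary (e : Nat.Primes → ℕ)
    (hbdry : ∀ (pp : Nat.Primes) (x : (thetaIndex (pilotDataOfK D K)).Fibre (.inr pp)),
      haveI : Fact (pp : ℕ).Prime := ⟨pp.2⟩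
      (∃ w : (thetaIndex (pilotDataOfK D K)).Fibre (.inr pp), placeOf (pilotDataOfK D K) pp.1 w ∈ (pilotDataOfK D K).S) →
        2 < (pp : ℕ) ∧ e pp ≤ (pp : ℕ) - 1 ∧ (placeOf (pilotDataOfK D K) pp.1 x).asIdeal.ramificationIdx ℤ = e pp ∧
          ∀ ζ : kOf (pilotDataOfK D K) pp.1 x, ζ ^ (pp : ℕ) = 1 → ζ = 1) :
    Thm311ToCor312.Licence
        (settingPrVolSharp (pilotDataOfK D K) hlog M archPk archSub Ψ act Mmod region n lat sig split qData tq t htq0 htq1) ↔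
      HStarBallBandLicence D := by
  rw [licence_settingPrVolSharp_pilotDataOfK_iff_of_boundary D hlog M archPk archSub Ψ act Mmod region n lat sig split qData tq t htq0
    htq1 ht0 ht htq e hbdry, hStarBall_iff]
  constructor
  · intro h pp i w hw hp2 hew hμ P hP
    haveI : Fact (pp : ℕ).Prime := ⟨pp.2⟩
    obtain ⟨-, -, hram, -⟩ := hbdry pp w ⟨w, hw⟩
    have he0 : (0 : ℤ) < ((placeOf (pilotDataOfK D K) pp.1 w).asIdeal.ramificationIdx ℤ : ℤ) := by
      exact_mod_cast ramificationIdx_placeOf_pos D pp w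
    have h1 := h pp i w hw P hP
    rw [← hram] at h1
    refine (cell_iff_tame_exact he0 _ _).2 ?_
    push_cast at h1 ⊢
    linarith
  · intro h pp i w hw P hP
    haveI : Fact (pp : ℕ).Prime := ⟨pp.2⟩
    obtain ⟨hp2, hep, hram, hμ⟩ := hbdry pp w ⟨w, hw⟩
    have he0 : (0 : ℤ) < ((placeOf (pilotDataOfK D K) pp.1 w).asIdeal.ramificationIdx ℤ : ℤ) := by
      exact_mod_cast ramificationIdx_placeOf_pos D pp w
    have h1 := h pp i w hw hp2 (by rw [hram]; exact hep) hμ P hP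
    have h2 := (cell_iff_tame_exact he0 _ _).1 h1
    rw [hram] at h2
    push_cast at h2 ⊢
    linarith

include ht0 ht htq in
/-- **THE k2 DOOR ON THE BALL STRATUM**: H⋆₅♭ ⟹ branch C's per-datum S_H antecedent «∃ ρ qK, QPinned ∧ PilotKummerCompatHull» at
`settingPrVolSharp (pilotDataOfK D K) …` (all bad fibres uniformly torsion-free sub-wild, realising ideles; any columns `col`).
[cite: Mochizuki2012, IUTchIII Step (xi) (xi-f) p. 184] [cite: DupuyHilado2025, §3.3, §3.4, §3.9, §4.9] [claim: Mochizuki2012, status: disputed] -/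
theorem exists_qPinned_and_hull_settingPrVolSharp_pilotDataOfK_of_hStarBall_of_boundary (e : Nat.Primes → ℕ)
    (hbdry : ∀ (pp : Nat.Primes) (x : (thetaIndex (pilotDataOfK D K)).Fibre (.inr pp)),
      haveI : Fact (pp : ℕ).Prime := ⟨pp.2⟩
      (∃ w : (thetaIndex (pilotDataOfK D K)).Fibre (.inr pp), placeOf (pilotDataOfK D K) pp.1 w ∈ (pilotDataOfK D K).S) →
        2 < (pp : ℕ) ∧ e pp ≤ (pp : ℕ) - 1 ∧ (placeOf (pilotDataOfK D K) pp.1 x).asIdeal.ramificationIdx ℤ = e pp ∧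
          ∀ ζ : kOf (pilotDataOfK D K) pp.1 x, ζ ^ (pp : ℕ) = 1 → ζ = 1)
    (hH : HStarBallBandLicence D) :
    ∃ (ρ : (∀ v : (thetaIndex (pilotDataOfK D K)).V, v ∈ (thetaIndex (pilotDataOfK D K)).Vbad →
            Set ((logShellsDH (pilotDataOfK D K) logv).StarPacket v)) →
          ∀ (j : (thetaIndex (pilotDataOfK D K)).Label) (vQ : (thetaIndex (pilotDataOfK D K)).VQ),
            Set ((logShellsDH (pilotDataOfK D K) logv).Packet j vQ))
        (qK : ∀ v : (thetaIndex (pilotDataOfK D K)).V, v ∈ (thetaIndex (pilotDataOfK D K)).Vbad →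
          Set ((logShellsDH (pilotDataOfK D K) logv).StarPacket v)),
        QPinned ({ toSituation := situationPrVol (pilotDataOfK D K) hlog M archPk archSub Ψ act Mmod region, col := col } :
            LatticeSituation (thetaIndex (pilotDataOfK D K)))
          (settingPrVolSharp (pilotDataOfK D K) hlog M archPk archSub Ψ act Mmod region n lat sig split qData tq t htq0 htq1) ρ qK ∧
        PilotKummerCompatHull ({ toSituation := situationPrVol (pilotDataOfK D K) hlog M archPk archSub Ψ act Mmod region, col := col } :
            LatticeSituation (thetaIndex (pilotDataOfK D K)))
          (settingPrVolSharp (pilotDataOfK D K) hlog M archPk archSub Ψ act Mmod region n lat sig split qData tq t htq0 htq1) ρ qK :=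
  (exists_qPinned_and_hull_settingPrVolSharp_iff_licence (pilotDataOfK D K) hlog M archPk archSub Ψ act Mmod region n lat sig split qData
      tq t htq0 htq1 col (fun pp x => norm_qIdele_le_one_of_realises (pilotDataOfK D K) tq htq0 htq pp x)).2
    ((licence_settingPrVolSharp_pilotDataOfK_iff_hStarBall_of_boundary D hlog M archPk archSub Ψ act Mmod region n lat sig split qData tq t
      htq0 htq1 ht0 ht htq e hbdry).2 hH)

end Summit.ABC.IUTFork.Repair.RH.TameBandLicence

end
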